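import Literature.NumberTheory.Automorphic.UnitaryCurveCohCotangentForms
import Literature.NumberTheory.Automorphic.UnitaryGroupCohomologicalForms
import Literature.NumberTheory.Automorphic.UnitaryGroupArchSection
import Literature.NumberTheory.Automorphic.SmoothRepresentation
import Literature.NumberTheory.Automorphic.Liu2021.Def411WeilCarriersAtLine
import Literature.NumberTheory.Automorphic.Liu2021.Def411WeilCarriersDoubling
import Literature.NumberTheory.Automorphic.UnitaryGroupLevelTransport
import Literature.NumberTheory.Automorphic.IdeleClassCharacterHecke
import Literature.RepresentationTheory.Liu2021.OscillatorConventions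
import Literature.AlgebraicGeometry.Liu2021.AdmissibleElement
import HarnessLib

/-!
# The SIGNED Hodge-type rule for theta finite components on the unitary Shimura CURVES — [Liu2021, Rem. D.5] in label-generic form
# (edition-2 companion of ★-pending `Rogawski1990/CurveCohomologicalSpectrum`: E3₂ = the signed refinement of its E2′₂θ `curveThetaHodgeTypeRigid`)

Topic `NumberTheory/Rogawski1990`; namespace `Literature.NumberTheory.Rogawski1990`.  STATEMENT-ONLY: two closed named facts `def … : Prop` (no `sorry`, no
instance, no notation, no new carrier).  HONEST DEBT: +2 named facts, 0 carriers.  Imports and SETTING = those of `CurveCohomologicalSpectrum.lean` (binder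
prefix copied token for token from the crux letter `S1BettiShape` of `Summits/…/Cruxes/HLiu418/Lines/F0_AlbCm.lean`: `L` CM with `[L:ℚ] ≥ 4`, `ι : L →+* ℂ`,
`H ∈ M₂(L)` with `formCongr c g (t • H) = diag dV`, signature `(1,1)` at `ι` and definite elsewhere read on `diag dV`, a cone frame `𝔣 : ConeFrame L H (cmPlace L ι)`
of ★ `UnitaryCurveCohCotangentForms`, an automorphic measure `μ`, Hodge types `P.IsHolCotangentAt₂ / IsAntiholCotangentAt₂` of ★ `UnitaryCurveCohCotangentForms` §5),
plus ★ `IdeleClassCharacterHecke` / `OscillatorConventions` (`toHeckeCharacter`, `isOscillatorChar_toHeckeCharacter_iff`: the splitting ATTACHED TO a conjugate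
symplectic idèle class character `λ`, [Liu2021, App. D Step 2]) and ★ `AlgebraicGeometry/Liu2021/AdmissibleElement` (`IsAdmissibleElement`, [Liu2021, Def. 4.12]).
The theta carrier is `ω(λ, ε_a, χ)_f` realised at the line `⟨a⟩` with the `λ`-splitting and pulled back along `(finAdelicCongr … g ht hg).symm` — the crux's
`ω⋆_lab` TERM at `λ := galConj c μ` (`hμ.galConj`), line `a := r.toFun ε` (checked by `rfl` in the seat's slot test).

THE LETTERS (CLASS **U** — readings; chain in each docstring): `curveThetaHodgeTypeSigned_hol` / `_antihol` — a `(1,0)`-type [resp. `(0,1)`-type] occurrence of a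
theta `σ ≅ ω(λ, ε_a, χ)_f` (`λ` conjugate symplectic OF WEIGHT ONE, CM type `Φ_λ = hλ.cmType`) forces `(e♮ ∈ Φ_λ ↔ ε_a is λ-admissible)` [resp. `(e♮ ∈ Φ_λ ↔ ε_a is NOT
λ-admissible)`], where **`e♮ := (cmPlace L ι).1.embedding ∈ {ι, ῑ}`** (Mathlib `embedding_mk_eq`) is THE EMBEDDING THAT DEFINES THE COMPLEX STRUCTURE of the
carriers (`ConeFrame`, `archLocal`, `IsConeHol` are built on `H.map w₁.1.embedding`, `w₁ = cmPlace L ι`) = print's `τ′₁` — NOT `ι` itself: every hypothesis sees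
only the PLACE of `ι`, so a conclusion keyed on `ι` would be vacuous-by-contradiction (F0P5-p04 (g0) read 2026-08-30T22:54Z, kernel cert); admissibility in the tree's direct form of [Liu2021, Def. 4.12]: `∃ e, IsAdmissibleElement L Φ_λ e ∧ epsOf L⁺ (imagUnitSq L) L (2·imagUnit L)⁻¹ e =
locF L⁺ (imagUnitSq L) a`.  SOURCE OF THE TOKENS: the F0P5 sign table `F0/P5/p04/SIGN-TABLE-RemD5.md` (desk-accepted 2026-08-30T22:36Z) §2 (Xs), LABEL-GENERIC variant
(invariant under the [Liu2021, Lem. D.1 (4)] relabelling; reduces to the `_hadm`-keyed form at `λ := μᶜ` by ★ `IsConjugateSymplectic.cmType_galConj` + ★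
`isAdmissibleElement_conj_neg_iff`).  The two letters together imply the sign-free `curveThetaHodgeTypeRigid`.  Cell `hodgecm-mathlib`, floor-0 programme P5
(`F0_AlbCm`, stub `stub_S1b_hodge`), seat F0P5-p02 (g0).  HC_CM is proved only modulo the printed citations until rung 0 closes; this file discharges none of them.

## References
* [Liu2021] Y. Liu, *Fourier–Jacobi cycles and arithmetic relative trace formula*, Camb. J. Math. 9 (2021) = arXiv:2102.11518: Def. 4.12 (held chunk p0020 L45–52),
  Rem. 4.2 / Def. 4.3 / Rem. 4.4 (CM type `Φ_μ` of a conjugate symplectic `μ`), App. D Lem. D.1 (4) (p0056 L29), Lem. D.2 (3) (p0057 L22), Prop. D.4 (1) and its proof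
  (p0058 L47 – p0059 L1), Rem. D.5 (p0059 L5–L12; FJcycle.tex l. 5396–5405), proof of Thm. D.6 (1) (FJcycle.tex l. 5625–5631).
* [Rogawski1990] J. Rogawski, *Automorphic representations of unitary groups in three variables*, Ann. of Math. Stud. 123 (1990), Ch. 11 (held chunks
  p0152–p0158): Prop. 11.1.1, Prop. 11.2.1, Thm. 11.5.1.
* [LabesseLanglands1979] J.-P. Labesse, R. P. Langlands, *L-indistinguishability for SL(2)*, Canad. J. Math. 31 (1979) (multiplicity formula for the packets
  `ρ(θ)`; cited through [Rogawski1990, §11.1]).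
-/

noncomputable section

open NumberField NumberField.InfinitePlace MeasureTheory IsDedekindDomain
open scoped Matrix ComplexOrder

namespace Literature.NumberTheory.Rogawski1990

open Literature.NumberTheory.Automorphic Literature.NumberTheory.Automorphic.UnitaryGroup
open Literature.NumberTheory.Automorphic.UnitaryGroup.CotangentForms (toQuotFun)
open Literature.NumberTheory.Automorphic.UnitaryCurveForms
open Literature.NumberTheory.Automorphic.Liu2021 Literature.NumberTheory.Automorphic.Liu2021.Def411WeilCarriers
open Literature.NumberTheory.Automorphic.Liu2021.Def411WeilCarriersDoubling
open Literature.NumberTheory.GaloisRepresentations Literature.NumberTheory.Automorphic.IdeleClassGroup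
open Literature.AlgebraicGeometry.Liu2021 (IsAdmissibleElement)
open Literature.NumberTheory.GelbartRogawski1991 Literature.NumberTheory.GelbartRogawski1991.UnitaryDualPair
open Literature.RepresentationTheory.Liu2021 Literature.RepresentationTheory.HarrisKudlaSweet1996

/-- **U** (E3₂, Hodge type `(1,0)`) **THE SIGNED RULE [Liu2021, Rem. D.5], label-generic form: a holomorphic occurrence of `ω(λ, ε_a, χ)_f` forces
`(e♮ ∈ Φ_λ ↔ ε_a is λ-admissible)`, `e♮ := (cmPlace L ι).1.embedding` (print's `τ′₁`: the embedding defining the complex structure of the cone carriers;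
`e♮ ∈ {ι, ῑ}`).**  Setting of `curveThetaHodgeTypeRigid` with the splitting character SPECIALISED to `χₕ := toHeckeCharacter L λ` for a
CONJUGATE SYMPLECTIC idèle class character `λ` of `L` (★ `IsConjugateSymplectic`; `isOscillatorChar_toHeckeCharacter_iff`) OF WEIGHT ONE (★ `HasWeight L λ 1`),
with CM type `Φ_λ := hλ.cmType` ([Liu2021, Rem. 4.2, Def. 4.3]: `Φ_μ` = the embeddings where the exponent of `μ_∞` is `−w`).  If an irreducible smooth `σ` embeds
into `ω(λ, ε_a, χ)_f` (pulled back to `U(H)(𝔸_{L⁺,f})` along `(finAdelicCongr … g ht hg).symm`) and occurs in a discrete `P` of Hodge type `(1,0)` at `ι`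
(`IsHolCotangentAt₂ … 𝔣`), then `e♮ ∈ Φ_λ` HOLDS IF AND ONLY IF `ε_a` IS `λ`-ADMISSIBLE in the sense of [Liu2021, Def. 4.12] «we say that `ε` is `μ`-admissible if
there exists some `e ∈ E^{×−}` such that `ε_v = e Nm_{E_v/F_v} E_v^×` for every nonarchimedean place `v` of `F`, and `τ′(e)` has negative imaginary part for every
`τ′ ∈ Φ_μ`» — tree form `∃ e, IsAdmissibleElement L Φ_λ e ∧ epsOf L⁺ (imagUnitSq L) L (2·imagUnit L)⁻¹ e = locF L⁺ (imagUnitSq L) a` (the collection of the line `⟨a⟩`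
is that of `(2δ_L)⁻¹ a ∈ L^{×−}`, ★ `epsOf_algebraMap_mul`).  READING.  [Liu2021, Rem. D.5] (FJcycle.tex l. 5396–5405, p. 131): «The proof of Proposition D.4 (1)
implies that for `π^∞ ≃ ω(μ,ε,χ)` that is endoscopic cohomological, we have `m_cusp(π^{(1,0)}_∞ ⊗ π^∞) = 1` (resp. `m_cusp(π^{(0,1)}_∞ ⊗ π^∞) = 1`) if and only if
there exists some `e ∈ E^{×−}` such that • `ε_v = e Nm_{E_v/F_v} E_v^×` for every nonarchimedean place `v` of `F`, • `τ′_i(e)` has negative imaginary part for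
`i = 2, …, d`, where `τ′_i` is the unique element in `Φ_μ` above `τ_i`, and • `τ′_1(e)` has negative (resp. positive) imaginary part.» — stated for the NORMAL-FORM
label of Prop. D.4 (1) («`μ` of weight one and satisfying `τ′₁ ∈ Φ_μ»), read at `τ′₁ := e♮` (the holomorphic structure of `holCotForms₂ … 𝔣` is that of
`X = Sh_K ⊗_{E,e♮} ℂ`; all hypotheses are invariant under `ι ↦ ῑ`, `cmPlace L ῑ = cmPlace L ι`, `(diag dV).map ῑ = (diag dV).map ι`), i.e. for `e♮ ∈ Φ_λ`:
then `(1,0)` iff `ε_a` is `λ`-admissible.  For `e♮ ∉ Φ_λ` the carrier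
is RELABELLED to normal form by [Liu2021, Lem. D.1 (4)] («If `n = 2` and `ω(μ,ε,χ)` is nonzero, then `ω(μ′,ε′,χ′) ≅ ω(μ,ε,χ)` iff either `(μ′,ε′,χ′) = (μ,ε,χ)`,
or `μ′ = μᶜ χ̌`, `χ′ = χ`, and `ε′ = ε` (resp. `ε′ ≠ ε`) when `V` is isotropic (resp. anisotropic)», place by place): label `λ′ = λᶜχ̌` with `Φ_{λ′} = Φ̄_λ ∋ e♮`,
`ε′ = ε` changed exactly on the set `T` of anisotropic finite places of `diag dV`; `(1,0)` iff `ε′` is `Φ̄_λ`-admissible iff (negating `e`, [Liu2021, Def. 4.12,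
last sentence]) some `Φ_λ`-negative `e` has collection `[−1]·ε′`; and «some `Φ_λ`-negative `e` has collection `ε`» and «some `Φ_λ`-negative `e` has collection
`[−1]·ε′`» are MUTUALLY EXCLUSIVE and JOINTLY EXHAUSTIVE: their ratio would be a totally positive `x ∈ L⁺` with `x ∉ Nm(L_v)` exactly for `v ∈ T` up to the
classes of `−1`, against Hilbert reciprocity for `L/L⁺` (`∏_v η_v(x) = 1`, `η_v(−1) = −1` at the `d` real places) since `#T ≡ d − 1 (mod 2)` under the signature
clauses (`(1,1)` at `ι`, definite at the `d − 1` other real places; ★ `even_ncard_not_isIsotropic_add_finrank_sub_one`, ★ `isAdmissible_epsOf_iff_even_card`,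
existence by ★ `QuadraticForms.exists_prescribed_normClass_of_finite`) — so for `e♮ ∉ Φ_λ`, `(1,0)` iff `ε_a` is NOT `λ`-admissible.  The Hodge type is read
on the `e♮`-cone carriers = holomorphic forms on print's curve `X = Sh_K ⊗_{E,τ′₁} ℂ`, `τ′₁ = e♮` ([Liu2021, §D.3 l. 5353–5355; proof of Thm. D.6 (1), l. 5625–5631:
«If `m_cusp(π^{(1,0)}_∞ ⊗ π^∞) = 1`, then `H¹_B(X,ℂ)[π^∞]` has Hodge type `(1,0)`»]); the archimedean dictionary is [Liu2021, Lem. D.2 (3)].  Multiplicity inputs as in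
`curveThetaHodgeTypeRigid` ([Rogawski1990, §11]; [LabesseLanglands1979]).  F0P5 sign table (Xs) at `λ := μᶜ` via ★ `IsConjugateSymplectic.cmType_galConj`,
★ `isAdmissibleElement_conj_neg_iff`.
[cite: Liu2021, App. D Rem. D.5 (p. 131); Prop. D.4 (1) and its proof (p. 130–131); Lem. D.1 (4); Lem. D.2 (3); Def. 4.12; proof of Thm. D.6 (1) (p. 140)]
[cite: Rogawski1990, §11.1 Prop. 11.1.1 (b), (d); Prop. 11.2.1 (b); Thm. 11.5.1 (b)] -/
def curveThetaHodgeTypeSigned_hol : Prop :=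
  ∀ (L : Type) [Field L] [NumberField L] [IsCMField L] (ι : L →+* ℂ) (H : Matrix (Fin 2) (Fin 2) L)
    (dV : Fin 2 → L) (hdV : ∀ i, IsCMField.complexConj L (dV i) = dV i) (hdV0 : ∀ i, dV i ≠ 0)
    (t : L) (ht : t ≠ 0) (g : GL (Fin 2) L)
    (hg : formCongr ((IsCMField.complexConj L : L ≃ₐ[↥(maximalRealSubfield L)] L) : L →+* L) g (t • H) = Matrix.diagonal dV),
    (∃ T : GL (Fin 2) ℂ, formCongr (starRingEnd ℂ) T ((Matrix.diagonal dV).map ι) = Matrix.diagonal ![(1 : ℂ), -1]) →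
    (∀ τ' : L →+* ℂ, InfinitePlace.mk τ' ≠ InfinitePlace.mk ι → ((Matrix.diagonal dV).map τ').PosDef) →
    4 ≤ Module.finrank ℚ L →
    ∀ (𝔣 : ConeFrame L H (cmPlace L ι))
      (μ : Measure (adelicGroupData (↥(maximalRealSubfield L)) L (IsCMField.complexConj L) 2 H).automorphicQuotient)
      [(adelicGroupData (↥(maximalRealSubfield L)) L (IsCMField.complexConj L) 2 H).IsAutomorphicMeasure μ]
      -- the ω-side data: reindexing, the LABEL `λ` (conjugate symplectic, weight one), line, central character
      {n' : ℕ} (e₁ : Fin 2 × Fin 1 ≃ Fin n')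
      (lam : Literature.NumberTheory.Automorphic.IdeleClassGroup L →ₜ* Circle) (hlam : IsConjugateSymplectic L lam), HasWeight L lam 1 →
    ∀ (a : (↥(maximalRealSubfield L))ˣ) (χ : Chi (↥(maximalRealSubfield L)) L (IsCMField.complexConj L))
      (W : Type) [AddCommGroup W] [Module ℂ W]
      (σ : Representation ℂ (finAdelic (↥(maximalRealSubfield L)) L (IsCMField.complexConj L) 2 H) W),
      σ.IsIrreducible → σ.IsSmooth →
    ∀ j : σ.IntertwiningMap
        ((rhoVAtLine (↥(maximalRealSubfield L)) L (IsCMField.complexConj L) 2 e₁ (Matrix.diagonal dV)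
            (complexConj_imagUnit L) (imagUnit_ne_zero L) (imagUnit_mul_self L) (realDiagonal_isSymm L dV hdV)
            (isUnit_det_realDiagonal L dV hdV hdV0) (realDiagonal_map L dV hdV).symm
            (fun a => isCompatible_chiSplittingLine L e₁ dV hdV hdV0 (toHeckeCharacter L lam)
              (isUnitary_toHeckeCharacter L lam) ((isOscillatorChar_toHeckeCharacter_iff lam).mpr hlam)
              (TW (↥(maximalRealSubfield L)) a) (isSymm_TW (↥(maximalRealSubfield L)) a)
              (isUnit_det_TW (↥(maximalRealSubfield L)) a) (JW (↥(maximalRealSubfield L)) L a)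
              (JW_eq (↥(maximalRealSubfield L)) L a)) a χ).comp
          (finAdelicCongr (↥(maximalRealSubfield L)) L (IsCMField.complexConj L) g ht hg).symm.toMonoidHom),
      Function.Injective j →
    ∀ P : DiscreteAutomorphicRep (adelicGroupData (↥(maximalRealSubfield L)) L (IsCMField.complexConj L) 2 H) μ,
      P.IsHolCotangentAt₂ (IsCMField.complexConj_ne_one L) (UnitaryGroup.complexConj_smul_infinitePlace L) (cmPlace L ι) 𝔣 →
      P.HasFinComponent σ →
      ((cmPlace L ι).1.embedding ∈ hlam.cmType.1 ↔
        ∃ e : L, IsAdmissibleElement L hlam.cmType.1 e ∧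
          epsOf (↥(maximalRealSubfield L)) (imagUnitSq L) L (2 * imagUnit L)⁻¹ e = locF (↥(maximalRealSubfield L)) (imagUnitSq L) a)

/-- **U** (E3₂, Hodge type `(0,1)`) **THE SIGNED RULE [Liu2021, Rem. D.5], label-generic form: an ANTIholomorphic occurrence of `ω(λ, ε_a, χ)_f` forces
`(e♮ ∈ Φ_λ ↔ ε_a is NOT λ-admissible)`, `e♮ := (cmPlace L ι).1.embedding`** — the statement of `curveThetaHodgeTypeSigned_hol` with `IsAntiholCotangentAt₂` and the
negated right-hand side;
same reading ([Liu2021, Rem. D.5] «resp.» clause: for the normal-form label, `(0,1)` iff some `e` with the collection `ε` is negative on `Φ_μ ∖ {τ′₁}` and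
POSITIVE at `τ′₁`, which under the reciprocity constraint `#T ≡ d − 1 (mod 2)` is the case iff `ε` is NOT `μ`-admissible; companion relabelling for `ι ∉ Φ_λ`)
and citations.  Together with `curveThetaHodgeTypeSigned_hol` it implies `curveThetaHodgeTypeRigid`.
[cite: Liu2021, App. D Rem. D.5 (p. 131); Prop. D.4 (1) and its proof (p. 130–131); Lem. D.1 (4); Lem. D.2 (3); Def. 4.12; proof of Thm. D.6 (1) (p. 140)]
[cite: Rogawski1990, §11.1 Prop. 11.1.1 (b), (d); Prop. 11.2.1 (b); Thm. 11.5.1 (b)] -/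
def curveThetaHodgeTypeSigned_antihol : Prop :=
  ∀ (L : Type) [Field L] [NumberField L] [IsCMField L] (ι : L →+* ℂ) (H : Matrix (Fin 2) (Fin 2) L)
    (dV : Fin 2 → L) (hdV : ∀ i, IsCMField.complexConj L (dV i) = dV i) (hdV0 : ∀ i, dV i ≠ 0)
    (t : L) (ht : t ≠ 0) (g : GL (Fin 2) L)
    (hg : formCongr ((IsCMField.complexConj L : L ≃ₐ[↥(maximalRealSubfield L)] L) : L →+* L) g (t • H) = Matrix.diagonal dV),
    (∃ T : GL (Fin 2) ℂ, formCongr (starRingEnd ℂ) T ((Matrix.diagonal dV).map ι) = Matrix.diagonal ![(1 : ℂ), -1]) →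
    (∀ τ' : L →+* ℂ, InfinitePlace.mk τ' ≠ InfinitePlace.mk ι → ((Matrix.diagonal dV).map τ').PosDef) →
    4 ≤ Module.finrank ℚ L →
    ∀ (𝔣 : ConeFrame L H (cmPlace L ι))
      (μ : Measure (adelicGroupData (↥(maximalRealSubfield L)) L (IsCMField.complexConj L) 2 H).automorphicQuotient)
      [(adelicGroupData (↥(maximalRealSubfield L)) L (IsCMField.complexConj L) 2 H).IsAutomorphicMeasure μ]
      {n' : ℕ} (e₁ : Fin 2 × Fin 1 ≃ Fin n')
      (lam : Literature.NumberTheory.Automorphic.IdeleClassGroup L →ₜ* Circle) (hlam : IsConjugateSymplectic L lam), HasWeight L lam 1 →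
    ∀ (a : (↥(maximalRealSubfield L))ˣ) (χ : Chi (↥(maximalRealSubfield L)) L (IsCMField.complexConj L))
      (W : Type) [AddCommGroup W] [Module ℂ W]
      (σ : Representation ℂ (finAdelic (↥(maximalRealSubfield L)) L (IsCMField.complexConj L) 2 H) W),
      σ.IsIrreducible → σ.IsSmooth →
    ∀ j : σ.IntertwiningMap
        ((rhoVAtLine (↥(maximalRealSubfield L)) L (IsCMField.complexConj L) 2 e₁ (Matrix.diagonal dV)
            (complexConj_imagUnit L) (imagUnit_ne_zero L) (imagUnit_mul_self L) (realDiagonal_isSymm L dV hdV)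
            (isUnit_det_realDiagonal L dV hdV hdV0) (realDiagonal_map L dV hdV).symm
            (fun a => isCompatible_chiSplittingLine L e₁ dV hdV hdV0 (toHeckeCharacter L lam)
              (isUnitary_toHeckeCharacter L lam) ((isOscillatorChar_toHeckeCharacter_iff lam).mpr hlam)
              (TW (↥(maximalRealSubfield L)) a) (isSymm_TW (↥(maximalRealSubfield L)) a)
              (isUnit_det_TW (↥(maximalRealSubfield L)) a) (JW (↥(maximalRealSubfield L)) L a)
              (JW_eq (↥(maximalRealSubfield L)) L a)) a χ).comp
          (finAdelicCongr (↥(maximalRealSubfield L)) L (IsCMField.complexConj L) g ht hg).symm.toMonoidHom),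
      Function.Injective j →
    ∀ P : DiscreteAutomorphicRep (adelicGroupData (↥(maximalRealSubfield L)) L (IsCMField.complexConj L) 2 H) μ,
      P.IsAntiholCotangentAt₂ (IsCMField.complexConj_ne_one L) (UnitaryGroup.complexConj_smul_infinitePlace L) (cmPlace L ι) 𝔣 →
      P.HasFinComponent σ →
      ((cmPlace L ι).1.embedding ∈ hlam.cmType.1 ↔
        ¬ ∃ e : L, IsAdmissibleElement L hlam.cmType.1 e ∧
          epsOf (↥(maximalRealSubfield L)) (imagUnitSq L) L (2 * imagUnit L)⁻¹ e = locF (↥(maximalRealSubfield L)) (imagUnitSq L) a)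

end Literature.NumberTheory.Rogawski1990

end
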